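import Mathlib
import Summits.Ventures.HodgeRepro.Tier4.Line4.ChainInputsBounded

/-!
# Tier4/Line4/ChainInputsGlobal — C-L4-CHAININPUTS-GLOBAL, part 2: the four sums (A2), (A4), `hs`, (B4) of
`ChainInputs` from the Poincaré clause, and the assembly of the bundle

Blind re-derivation cell `pub-hodge-repro`, Tier 4 «prove the step» (README §9–§10), seat t4-L2-p3 (gen 5; plan-4 g6's
cut S15809 / S15814 with L4-x2's census S15812 as the brief; statements S15822).  Tree path
`lean/Summits/Ventures/HodgeRepro/Tier4/Line4/ChainInputsGlobal.lean`.  Imports part 1 (`ChainInputsBounded`).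

* the Poincaré clause enters every sum lemma INLINE as the hypothesis `hP : ∀ C₁ C₂ compact, ∃ M, ∀ x ∈ C₁, y ∈ C₂,
  Summable (γ ↦ ‖F (x⁻¹ γ y)‖) ∧ ∑′ ≤ M` over `rationalPoints W` (= `L1Class.PoincareSummable (Setting.ofAdelicData …) F`
  by `rfl` — no `def`, kernel lane);
* `sum_integral_norm_innerFn_le`, `integral_norm_innerFn_le`, `integrable_integral_norm_innerFn`,
  `continuous_integral_norm_innerFn`: the partial sums `∑_{γ ∈ s} ∫_{D_{T′}} ‖F(t⁻¹ γ t′)‖ = ∫_{D_{T′}} ∑_{γ ∈ s} ‖…‖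
  ≤ M μ_{T′}(D_{T′})` and the inner `L¹`-norm function;
* (d) `summable_integral_norm_innerFn_orbit_of_poincare` (A2), `summable_double_integral_norm_of_poincare`,
  `summable_integral_norm_chi_mul_innerInt_orbit_of_poincare` (A4), `summable_orbitalc_orbit_of_poincare` (`hs`),
  `summable_integral_norm_chi_mul_innerInt_rational_of_poincare` (B4) — `summable_of_sum_le` on the finite partial
  sums, restricted to the orbit (`Summable.subtype`), dominated (`Summable.of_nonneg_of_le`, `Summable.of_norm_bounded`)
  and composed along the injection `δ′ ↦ δ⁻¹ γ₀ δ′` (`Summable.comp_injective`);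
* **`chainInputs_of_pieces`** — THE ASSEMBLY: `ChainInputs` from the nine GLOBAL clauses, with (B1) and the five
  FIN / ARCH clauses as hypotheses (L1-p1's ChainInputsFin, L4-x2's ConvInfRegularity, by name at the witness).

No printed input is consumed.  HC_CM is NOT proved by anyone in this repository.
-/

set_option autoImplicit false
noncomputable section
namespace Summit.Ventures.HodgeRepro.Tier4.Line4
open Summit.Ventures.HodgeRepro.Tier4 Summit.Ventures.HodgeRepro.Tier4.Common
  Summit.Ventures.HodgeRepro.Tier4.Line1 MeasureTheory
open scoped ComplexConjugate Topology Pointwise NNReal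

section Sums
variable {k : Type} [Field k] [NumberField k] (W : PlaneData k) [MeasurableSpace (GA W)] [BorelSpace (GA W)]
  (R : RTFData W)

/-- the partial-sum bound of the inner `L¹`-norms over any finite set of rational points, for `t` and the `t′` in
`D_{T′}` — the Poincaré clause integrated over `D_{T′}`. -/
theorem sum_integral_norm_innerFn_le (hR : R.IsHaar) (hc' : Continuous R.chi') (hu' : ∀ a, ‖R.chi' a‖ = 1)
    (F : GA W → ℂ) (hFc : Continuous F) (C : ℝ) (hC : ∀ x, ‖F x‖ ≤ C) (t : torusT W) (M : ℝ)
    (hM : ∀ t' ∈ R.DT', ∑' γ : rationalPoints W, ‖F ((t : GA W)⁻¹ * (γ : GA W) * (t' : GA W))‖ ≤ M)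
    (hsumm : ∀ t' ∈ R.DT', Summable (fun γ : rationalPoints W => ‖F ((t : GA W)⁻¹ * (γ : GA W) * (t' : GA W))‖))
    (s : Finset (rationalPoints W)) :
    ∑ γ ∈ s, ∫ t' in R.DT', ‖innerFn W R F (γ : GA W) t t'‖ ∂(R.μT') ≤ M * (R.μT' R.DT').toReal := by
  haveI : R.μT'.IsHaarMeasure := hR.2.1
  haveI : IsFiniteMeasure (R.μT'.restrict R.DT') := isFiniteMeasure_restrict.2 hR.2.2.2.2.2.ne
  have hint : ∀ γ : rationalPoints W, Integrable (fun t' => ‖innerFn W R F (γ : GA W) t t'‖) (R.μT'.restrict R.DT') :=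
    fun γ => (integrable_innerFn_restrict_of_bound W R hR hc' hu' F hFc C hC (γ : GA W) t).norm
  rw [← integral_finsetSum s fun γ _ => hint γ]
  have hnull : NullMeasurableSet R.DT' R.μT' := R.DT'_fund.nullMeasurableSet
  have hbound : ∀ᵐ t' ∂(R.μT'.restrict R.DT'), ∑ γ ∈ s, ‖innerFn W R F (γ : GA W) t t'‖ ≤ M := by
    rw [ae_restrict_iff'₀ hnull]
    refine ae_of_all _ fun t' ht' => ?_
    calc ∑ γ ∈ s, ‖innerFn W R F (γ : GA W) t t'‖
        = ∑ γ ∈ s, ‖F ((t : GA W)⁻¹ * (γ : GA W) * (t' : GA W))‖ := by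
          refine Finset.sum_congr rfl fun γ _ => norm_innerFn_eq W R hu' F (γ : GA W) t t'
      _ ≤ ∑' γ : rationalPoints W, ‖F ((t : GA W)⁻¹ * (γ : GA W) * (t' : GA W))‖ :=
          (hsumm t' ht').sum_le_tsum s (fun _ _ => norm_nonneg _)
      _ ≤ M := hM t' ht'
  calc ∫ t' in R.DT', ∑ γ ∈ s, ‖innerFn W R F (γ : GA W) t t'‖ ∂(R.μT')
      ≤ ∫ _t' in R.DT', M ∂(R.μT') :=
        integral_mono_ae (integrable_finsetSum s fun γ _ => hint γ) (integrable_const M) hbound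
    _ = M * (R.μT' R.DT').toReal := by
        rw [setIntegral_const, smul_eq_mul, measureReal_def, mul_comm]

/-- the inner `L¹`-norm function `t ↦ ∫_{D_{T′}} ‖innerFn‖` is continuous (dominated convergence). -/
theorem continuous_integral_norm_innerFn (hR : R.IsHaar) (hc' : Continuous R.chi') (hu' : ∀ a, ‖R.chi' a‖ = 1)
    (F : GA W → ℂ) (hFc : Continuous F) (C : ℝ) (hC : ∀ x, ‖F x‖ ≤ C) (γ : GA W) :
    Continuous fun t : torusT W => ∫ t' in R.DT', ‖innerFn W R F γ t t'‖ ∂(R.μT') := by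
  haveI : SecondCountableTopology (GA W) := secondCountable_GA W
  haveI : SecondCountableTopology (torusT W) := TopologicalSpace.Subtype.secondCountableTopology (torusT W : Set (GA W))
  haveI : SecondCountableTopology (torusT' W) :=
    TopologicalSpace.Subtype.secondCountableTopology (torusT' W : Set (GA W))
  haveI : IsFiniteMeasure (R.μT'.restrict R.DT') := isFiniteMeasure_restrict.2 hR.2.2.2.2.2.ne
  refine continuous_of_dominated (bound := fun _ => C) (fun t => ?_)
    (fun t => ae_of_all _ fun t' => ?_) (integrable_const C) (ae_of_all _ fun t' => ?_)
  · exact (continuous_innerFn W R hc' F hFc γ t).norm.aestronglyMeasurable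
  · rw [norm_norm]
    exact norm_innerFn_le W R hu' F C hC γ t t'
  · refine Continuous.norm ?_
    unfold innerFn RTFData.chi'conj
    exact continuous_const.mul
      (hFc.comp ((continuous_subtype_val.inv.mul continuous_const).mul continuous_const))

/-- the inner `L¹`-norm is bounded by `C · μ_{T′}(D_{T′})`. -/
theorem integral_norm_innerFn_le (hR : R.IsHaar) (hc' : Continuous R.chi') (hu' : ∀ a, ‖R.chi' a‖ = 1)
    (F : GA W → ℂ) (hFc : Continuous F) (C : ℝ) (hC : ∀ x, ‖F x‖ ≤ C) (γ : GA W) (t : torusT W) :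
    ∫ t' in R.DT', ‖innerFn W R F γ t t'‖ ∂(R.μT') ≤ C * (R.μT' R.DT').toReal := by
  haveI : IsFiniteMeasure (R.μT'.restrict R.DT') := isFiniteMeasure_restrict.2 hR.2.2.2.2.2.ne
  calc ∫ t' in R.DT', ‖innerFn W R F γ t t'‖ ∂(R.μT') ≤ ∫ _t' in R.DT', C ∂(R.μT') :=
        integral_mono (integrable_innerFn_restrict_of_bound W R hR hc' hu' F hFc C hC γ t).norm (integrable_const C)
          fun t' => norm_innerFn_le W R hu' F C hC γ t t'
    _ = C * (R.μT' R.DT').toReal := by rw [setIntegral_const, smul_eq_mul, measureReal_def, mul_comm]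

/-- the inner `L¹`-norm function `t ↦ ∫_{D_{T′}} ‖innerFn‖` is integrable on `D_T` (continuous, bounded). -/
theorem integrable_integral_norm_innerFn (hR : R.IsHaar) (hc' : Continuous R.chi') (hu' : ∀ a, ‖R.chi' a‖ = 1)
    (F : GA W → ℂ) (hFc : Continuous F) (C : ℝ) (hC : ∀ x, ‖F x‖ ≤ C) (γ : GA W) :
    Integrable (fun t : torusT W => ∫ t' in R.DT', ‖innerFn W R F γ t t'‖ ∂(R.μT')) (R.μT.restrict R.DT) := by
  haveI : SecondCountableTopology (GA W) := secondCountable_GA W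
  haveI : SecondCountableTopology (torusT W) := TopologicalSpace.Subtype.secondCountableTopology (torusT W : Set (GA W))
  haveI : IsFiniteMeasure (R.μT.restrict R.DT) := isFiniteMeasure_restrict.2 hR.2.2.2.1.ne
  refine Integrable.mono' (integrable_const (C * (R.μT' R.DT').toReal))
    (continuous_integral_norm_innerFn W R hR hc' hu' F hFc C hC γ).aestronglyMeasurable (ae_of_all _ fun t => ?_)
  rw [Real.norm_of_nonneg (integral_nonneg fun _ => norm_nonneg _)]
  exact integral_norm_innerFn_le W R hR hc' hu' F hFc C hC γ t

/-- **(A2) from the Poincaré clause**: for fixed `t` the orbit sum of the inner `L¹`-norms is summable —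
`∑_{γ ∈ s} ∫_{D_{T′}} ‖F(t⁻¹ γ t′)‖ = ∫_{D_{T′}} ∑_{γ ∈ s} ‖…‖ ≤ M μ_{T′}(D_{T′})` for every finite `s`. -/
theorem summable_integral_norm_innerFn_orbit_of_poincare (hR : R.IsHaar) (hc' : Continuous R.chi')
    (hu' : ∀ a, ‖R.chi' a‖ = 1) (compT' : IsCompact (closure R.DT')) (F : GA W → ℂ) (hFc : Continuous F)
    (C : ℝ) (hC : ∀ x, ‖F x‖ ≤ C) (hP : ∀ C₁ C₂ : Set (GA W), IsCompact C₁ → IsCompact C₂ → ∃ M : ℝ, ∀ x ∈ C₁, ∀ y ∈ C₂,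
      Summable (fun γ : rationalPoints W => ‖F (x⁻¹ * (γ : GA W) * y)‖) ∧
        ∑' γ : rationalPoints W, ‖F (x⁻¹ * (γ : GA W) * y)‖ ≤ M) (γ₀ : rationalPoints W) (t : torusT W) :
    Summable (fun γ : Set.range (orbitMap W γ₀) =>
      ∫ t' in R.DT', ‖innerFn W R F ((γ : rationalPoints W) : GA W) t t'‖ ∂(R.μT')) := by
  obtain ⟨M, hM⟩ := hP {(t : GA W)} ((fun t' : torusT' W => (t' : GA W)) '' closure R.DT') isCompact_singleton
    (compT'.image continuous_subtype_val)
  have hsum : Summable (fun γ : rationalPoints W => ∫ t' in R.DT', ‖innerFn W R F (γ : GA W) t t'‖ ∂(R.μT')) := by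
    refine summable_of_sum_le (c := M * (R.μT' R.DT').toReal) (fun γ => integral_nonneg fun _ => norm_nonneg _)
      fun s => ?_
    exact sum_integral_norm_innerFn_le W R hR hc' hu' F hFc C hC t M
      (fun t' ht' => (hM (t : GA W) (Set.mem_singleton _) (t' : GA W) ⟨t', subset_closure ht', rfl⟩).2)
      (fun t' ht' => (hM (t : GA W) (Set.mem_singleton _) (t' : GA W) ⟨t', subset_closure ht', rfl⟩).1) s
  exact hsum.subtype _

/-- the double `L¹`-norm `b γ := ∫_{D_T} ∫_{D_{T′}} ‖F(t⁻¹ γ t′)‖` is summable over the rational points (the Poincaré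
clause on `closure D_T × closure D_{T′}`). -/
theorem summable_double_integral_norm_of_poincare (hR : R.IsHaar) (hc' : Continuous R.chi')
    (hu' : ∀ a, ‖R.chi' a‖ = 1) (compT : IsCompact (closure R.DT)) (compT' : IsCompact (closure R.DT'))
    (F : GA W → ℂ) (hFc : Continuous F) (C : ℝ) (hC : ∀ x, ‖F x‖ ≤ C) (hP : ∀ C₁ C₂ : Set (GA W), IsCompact C₁ → IsCompact C₂ → ∃ M : ℝ, ∀ x ∈ C₁, ∀ y ∈ C₂,
      Summable (fun γ : rationalPoints W => ‖F (x⁻¹ * (γ : GA W) * y)‖) ∧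
        ∑' γ : rationalPoints W, ‖F (x⁻¹ * (γ : GA W) * y)‖ ≤ M) :
    Summable (fun γ : rationalPoints W =>
      ∫ t in R.DT, (∫ t' in R.DT', ‖innerFn W R F (γ : GA W) t t'‖ ∂(R.μT')) ∂(R.μT)) := by
  haveI : R.μT.IsHaarMeasure := hR.1
  haveI : SecondCountableTopology (GA W) := secondCountable_GA W
  haveI : SecondCountableTopology (torusT W) := TopologicalSpace.Subtype.secondCountableTopology (torusT W : Set (GA W))
  haveI : IsFiniteMeasure (R.μT.restrict R.DT) := isFiniteMeasure_restrict.2 hR.2.2.2.1.ne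
  obtain ⟨M, hM⟩ := hP ((fun t : torusT W => (t : GA W)) '' closure R.DT)
    ((fun t' : torusT' W => (t' : GA W)) '' closure R.DT') (compT.image continuous_subtype_val)
    (compT'.image continuous_subtype_val)
  have hinner_int : ∀ γ : rationalPoints W,
      Integrable (fun t : torusT W => ∫ t' in R.DT', ‖innerFn W R F (γ : GA W) t t'‖ ∂(R.μT')) (R.μT.restrict R.DT) :=
    fun γ => integrable_integral_norm_innerFn W R hR hc' hu' F hFc C hC (γ : GA W)
  refine summable_of_sum_le (c := M * (R.μT' R.DT').toReal * (R.μT R.DT).toReal)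
    (fun γ => integral_nonneg fun _ => integral_nonneg fun _ => norm_nonneg _) fun s => ?_
  rw [← integral_finsetSum s fun γ _ => hinner_int γ]
  have hnull : NullMeasurableSet R.DT R.μT := R.DT_fund.nullMeasurableSet
  have hbound : ∀ᵐ t ∂(R.μT.restrict R.DT),
      ∑ γ ∈ s, ∫ t' in R.DT', ‖innerFn W R F (γ : GA W) t t'‖ ∂(R.μT') ≤ M * (R.μT' R.DT').toReal := by
    rw [ae_restrict_iff'₀ hnull]
    refine ae_of_all _ fun t ht => ?_
    exact sum_integral_norm_innerFn_le W R hR hc' hu' F hFc C hC t M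
      (fun t' ht' => (hM (t : GA W) ⟨t, subset_closure ht, rfl⟩ (t' : GA W) ⟨t', subset_closure ht', rfl⟩).2)
      (fun t' ht' => (hM (t : GA W) ⟨t, subset_closure ht, rfl⟩ (t' : GA W) ⟨t', subset_closure ht', rfl⟩).1) s
  calc ∫ t in R.DT, ∑ γ ∈ s, ∫ t' in R.DT', ‖innerFn W R F (γ : GA W) t t'‖ ∂(R.μT') ∂(R.μT)
      ≤ ∫ _t in R.DT, M * (R.μT' R.DT').toReal ∂(R.μT) :=
        integral_mono_ae (integrable_finsetSum s fun γ _ => hinner_int γ) (integrable_const _) hbound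
    _ = M * (R.μT' R.DT').toReal * (R.μT R.DT).toReal := by
        rw [setIntegral_const, smul_eq_mul, measureReal_def, mul_comm]

/-- **(A4) from the Poincaré clause**: the orbit sum of the outer `L¹`-norms is summable — dominated by the double
`L¹`-norms (`‖χ I_γ(t)‖ ≤ ∫_{D_{T′}} ‖innerFn‖`). -/
theorem summable_integral_norm_chi_mul_innerInt_orbit_of_poincare (hR : R.IsHaar) (hc : Continuous R.chi)
    (hu : ∀ a, ‖R.chi a‖ = 1) (hc' : Continuous R.chi') (hu' : ∀ a, ‖R.chi' a‖ = 1)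
    (compT : IsCompact (closure R.DT)) (compT' : IsCompact (closure R.DT')) (F : GA W → ℂ) (hFc : Continuous F)
    (C : ℝ) (hC : ∀ x, ‖F x‖ ≤ C) (hP : ∀ C₁ C₂ : Set (GA W), IsCompact C₁ → IsCompact C₂ → ∃ M : ℝ, ∀ x ∈ C₁, ∀ y ∈ C₂,
      Summable (fun γ : rationalPoints W => ‖F (x⁻¹ * (γ : GA W) * y)‖) ∧
        ∑' γ : rationalPoints W, ‖F (x⁻¹ * (γ : GA W) * y)‖ ≤ M) (γ₀ : rationalPoints W) :
    Summable (fun γ : Set.range (orbitMap W γ₀) =>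
      ∫ t in R.DT, ‖R.chi t * innerInt W R F ((γ : rationalPoints W) : GA W) t‖ ∂(R.μT)) := by
  haveI : R.μT.IsHaarMeasure := hR.1
  haveI : SecondCountableTopology (GA W) := secondCountable_GA W
  haveI : SecondCountableTopology (torusT W) := TopologicalSpace.Subtype.secondCountableTopology (torusT W : Set (GA W))
  haveI : IsFiniteMeasure (R.μT.restrict R.DT) := isFiniteMeasure_restrict.2 hR.2.2.2.1.ne
  have hdom := summable_double_integral_norm_of_poincare W R hR hc' hu' compT compT' F hFc C hC hP
  have hsum : Summable (fun γ : rationalPoints W =>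
      ∫ t in R.DT, ‖R.chi t * innerInt W R F (γ : GA W) t‖ ∂(R.μT)) := by
    refine Summable.of_nonneg_of_le (fun γ => integral_nonneg fun _ => norm_nonneg _) (fun γ => ?_) hdom
    have hinner_int : Integrable (fun t : torusT W => ∫ t' in R.DT', ‖innerFn W R F (γ : GA W) t t'‖ ∂(R.μT'))
        (R.μT.restrict R.DT) := integrable_integral_norm_innerFn W R hR hc' hu' F hFc C hC (γ : GA W)
    refine integral_mono
      (integrable_chi_mul_innerInt_restrict_of_bound W R hR hc hu hc' hu' F hFc C hC (γ : GA W)).norm hinner_int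
      fun t => ?_
    rw [norm_mul, hu, one_mul]
    exact norm_integral_le_integral_norm _
  exact hsum.subtype _

/-- **`hs` from (A4)**: the orbit sum of the folded orbital integrals converges absolutely,
`‖orbitalc γ F‖ ≤ ∫_{D_T} ‖χ I_γ‖`. -/
theorem summable_orbitalc_orbit_of_poincare (hR : R.IsHaar) (hc : Continuous R.chi)
    (hu : ∀ a, ‖R.chi a‖ = 1) (hc' : Continuous R.chi') (hu' : ∀ a, ‖R.chi' a‖ = 1)
    (compT : IsCompact (closure R.DT)) (compT' : IsCompact (closure R.DT')) (F : GA W → ℂ) (hFc : Continuous F)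
    (C : ℝ) (hC : ∀ x, ‖F x‖ ≤ C) (hP : ∀ C₁ C₂ : Set (GA W), IsCompact C₁ → IsCompact C₂ → ∃ M : ℝ, ∀ x ∈ C₁, ∀ y ∈ C₂,
      Summable (fun γ : rationalPoints W => ‖F (x⁻¹ * (γ : GA W) * y)‖) ∧
        ∑' γ : rationalPoints W, ‖F (x⁻¹ * (γ : GA W) * y)‖ ≤ M) (γ₀ : rationalPoints W) :
    Summable (fun γ : Set.range (orbitMap W γ₀) => R.orbitalc ((γ : rationalPoints W) : GA W) F) := by
  refine Summable.of_norm_bounded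
    (summable_integral_norm_chi_mul_innerInt_orbit_of_poincare W R hR hc hu hc' hu' compT compT' F hFc C hC hP γ₀)
    fun γ => ?_
  rw [orbitalc_eq_integral W R F _ (fun t => integrable_innerFn_restrict_of_bound W R hR hc' hu' F hFc C hC _ t)
    (integrable_chi_mul_innerInt_restrict_of_bound W R hR hc hu hc' hu' F hFc C hC _)]
  exact norm_integral_le_integral_norm _

/-- **(B4) from (A4)**: for fixed rational `δ` the `T′(k)`-sum of the outer `L¹`-norms is summable — the family is the
orbit family composed with the injection `δ′ ↦ δ⁻¹ γ₀ δ′`. -/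
theorem summable_integral_norm_chi_mul_innerInt_rational_of_poincare (hR : R.IsHaar) (hc : Continuous R.chi)
    (hu : ∀ a, ‖R.chi a‖ = 1) (hc' : Continuous R.chi') (hu' : ∀ a, ‖R.chi' a‖ = 1)
    (compT : IsCompact (closure R.DT)) (compT' : IsCompact (closure R.DT')) (F : GA W → ℂ) (hFc : Continuous F)
    (C : ℝ) (hC : ∀ x, ‖F x‖ ≤ C) (hP : ∀ C₁ C₂ : Set (GA W), IsCompact C₁ → IsCompact C₂ → ∃ M : ℝ, ∀ x ∈ C₁, ∀ y ∈ C₂,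
      Summable (fun γ : rationalPoints W => ‖F (x⁻¹ * (γ : GA W) * y)‖) ∧
        ∑' γ : rationalPoints W, ‖F (x⁻¹ * (γ : GA W) * y)‖ ≤ M) (γ₀ : rationalPoints W)
    (δ : rationalOf W (torusT W)) :
    Summable (fun δ' : rationalOf W (torusT' W) =>
      ∫ t in R.DT, ‖R.chi t * innerInt W R F (((δ : torusT W) : GA W)⁻¹ * (γ₀ : GA W) * ((δ' : torusT' W) : GA W)) t‖
        ∂(R.μT)) := by
  have hsum := summable_integral_norm_chi_mul_innerInt_orbit_of_poincare W R hR hc hu hc' hu' compT compT' F hFc C hC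
    hP γ₀
  let ι : rationalOf W (torusT' W) → Set.range (orbitMap W γ₀) := fun δ' => ⟨orbitMap W γ₀ (δ, δ'), ⟨(δ, δ'), rfl⟩⟩
  have hinj : Function.Injective ι := by
    intro δ' δ'' h
    have h1 : ((orbitMap W γ₀ (δ, δ') : rationalPoints W) : GA W) = ((orbitMap W γ₀ (δ, δ'') : rationalPoints W) : GA W) := by
      have := congrArg (fun x : Set.range (orbitMap W γ₀) => ((x : rationalPoints W) : GA W)) h
      exact this
    rw [orbitMap_val, orbitMap_val] at h1
    have h2 : ((δ' : torusT' W) : GA W) = ((δ'' : torusT' W) : GA W) := mul_left_cancel h1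
    exact Subtype.ext (Subtype.ext h2)
  refine (hsum.comp_injective hinj).congr fun δ' => ?_
  simp only [Function.comp_apply, ι, orbitMap_val]

end Sums

section Assembly
variable {k : Type} [Field k] [NumberField k] (W : PlaneData k) [MeasurableSpace (GA W)] [BorelSpace (GA W)]
  (R : RTFData W)

/-- **THE ASSEMBLY**: `ChainInputs` for a bounded product test function with the Poincaré clause — the nine GLOBAL
clauses by the theorems above, (B1) and the five FIN / ARCH clauses as hypotheses. -/
theorem chainInputs_of_pieces [CompactSpace (torusInf' W)] (hR : R.IsHaar) (hc : Continuous R.chi)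
    (hu : ∀ a, ‖R.chi a‖ = 1) (hc' : Continuous R.chi') (hu' : ∀ a, ‖R.chi' a‖ = 1)
    (compT : IsCompact (closure R.DT)) (compT' : IsCompact (closure R.DT')) (γ₀ : rationalPoints W)
    (νinf : Measure (torusInf W)) (νf : Measure (torusFin W)) (νinf' : Measure (torusInf' W))
    (νf' : Measure (torusFin' W)) (DZf : Set (torusFin W)) {F Finf Ffin : GA W → ℂ}
    (hF : IsProductFn W F Finf Ffin) (hFinfc : Continuous Finf) (C : ℝ) (hC : ∀ x, ‖Finf x‖ ≤ C)
    (hfin : L1Class.IsFinFactor W Ffin) (hP : ∀ C₁ C₂ : Set (GA W), IsCompact C₁ → IsCompact C₂ → ∃ M : ℝ, ∀ x ∈ C₁, ∀ y ∈ C₂,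
      Summable (fun γ : rationalPoints W => ‖F (x⁻¹ * (γ : GA W) * y)‖) ∧
        ∑' γ : rationalPoints W, ‖F (x⁻¹ * (γ : GA W) * y)‖ ≤ M)
    (hB1 : IntegrableOn (fun t : torusT W => R.chi t * innerFull W R F (γ₀ : GA W) t) (prodDomain W DZf) R.μT)
    (hA : ∀ t : torusT W, Integrable (fun a : torusInf' W => conj (R.chi' (a : torusT' W)) *
      Finf ((GA.ofInfPart W t)⁻¹ * GA.ofInfPart W (γ₀ : GA W) * ((a : torusT' W) : GA W))) νinf')
    (hB : ∀ t : torusT W, Integrable (fun b : torusFin' W => conj (R.chi' (b : torusT' W)) *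
      Ffin ((GA.ofFinPart W t)⁻¹ * GA.ofFinPart W (γ₀ : GA W) * ((b : torusT' W) : GA W))) νf')
    (hIinf : Integrable (fun a : torusInf W => R.chi a * innerInf W R Finf (γ₀ : GA W) νinf' a) νinf)
    (hIfin : IntegrableOn (fun b : torusFin W => R.chi b * innerFin W R Ffin (γ₀ : GA W) νf' b) DZf νf)
    (hint : IntegrableOn (fun p : torusFin W × torusFin' W => R.chi p.1 * conj (R.chi' p.2) *
      Ffin ((((p.1 : torusT W) : GA W))⁻¹ * GA.ofFinPart W (γ₀ : GA W) * ((p.2 : torusT' W) : GA W)))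
      (DZf ×ˢ Set.univ) (νf.prod νf')) :
    ChainInputs W R γ₀ νinf νf νinf' νf' DZf F Finf Ffin := by
  obtain ⟨C', hC'⟩ := exists_bound_of_isProductFn W hF C hC hfin
  have hFc : Continuous F := by
    have : F = fun g => Finf (GA.ofInfPart W g) * Ffin (GA.ofFinPart W g) := funext hF
    rw [this]
    exact (hFinfc.comp (continuous_ofInfPart W)).mul (hfin.cont.comp (continuous_ofFinPart W))
  exact
    { hA1 := fun γ t => integrable_innerFn_restrict_of_bound W R hR hc' hu' F hFc C' hC' (γ : GA W) t
      hA2 := fun t => summable_integral_norm_innerFn_orbit_of_poincare W R hR hc' hu' compT' F hFc C' hC' hP γ₀ t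
      hA3 := fun γ => integrable_chi_mul_innerInt_restrict_of_bound W R hR hc hu hc' hu' F hFc C' hC' (γ : GA W)
      hA4 := summable_integral_norm_chi_mul_innerInt_orbit_of_poincare W R hR hc hu hc' hu' compT compT' F hFc C' hC'
        hP γ₀
      hs := summable_orbitalc_orbit_of_poincare W R hR hc hu hc' hu' compT compT' F hFc C' hC' hP γ₀
      hB1 := hB1
      hB2 := fun s => integrable_innerFn_full_of_isProductFn W R hR hc' hu' hF hFinfc hfin (γ₀ : GA W) s
      hB3 := fun δ δ' => integrable_chi_mul_innerInt_restrict_of_bound W R hR hc hu hc' hu' F hFc C' hC' _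
      hB4 := fun δ => summable_integral_norm_chi_mul_innerInt_rational_of_poincare W R hR hc hu hc' hu' compT compT'
        F hFc C' hC' hP γ₀ δ
      hA := hA
      hB := hB
      hIinf := hIinf
      hIfin := hIfin
      hint := hint }

end Assembly

end Summit.Ventures.HodgeRepro.Tier4.Line4
end
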